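import Summits.CriticalPhenomena.PercolationContinuityZ3.Theorems.Transplant.FKConnectivityAllQAntipodalMajMixNested
import Summits.CriticalPhenomena.PercolationContinuityZ3.Theorems.Transplant.FKConnectivityAllQAntipodalThetaGluing
import HarnessLib

/-!
# Connectivity correlation inequalities for `φ_{w,q}`, every `q > 0` — file 51b: the MIXED part of the MIX CRITERION — the `x₁`-flips of
# `maj₃` at mixed positions of `x₂, x₃`, aggregated by the state of the second network

Support file (`--supports stmt-CriticalPhenomena-4575`), FK sub-lane `prim-bschramm-fk-2` (gen 25); builds on p205010 (kernel theorem,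
internal audit signed; external expert review pending).  No definitions, no named facts, no sorries; standard axioms.

HOST `H = E₁ ∪ E'` (two edge-disjoint two-terminal series–parallel networks between `a, b`, meeting only in `{a, b}`, `ab ∉ E₁`), specials
`x₁ ∈ E₁`, `x₂ ≠ x₃ ∈ E'`, a cell `(N₁ ∪ N', C₁ ∪ C')` off the specials, an antitone level weight `w`, an increasing `g` blind to the
specials.  `FK.apPsiCW_maj3_mixed_nonneg`: IF the levelwise MIXED root functional of `E'` is nonnegative against every monotone test
function (`hMIX`, memo FROM-fk-2-g24-BLACKBOX §4.3), THEN the `x₁`-flips of the host at the configurations with exactly one of `x₂, x₃`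
in the first replica, weighted by the increment of `g`, have nonnegative sum.  Proof = the aggregation step of the flow criterion
(memo §4.2): glue the level from the two networks (`FK.apExpC_parallel`); group the flips by the terminal state of `E'` in the two
replicas — both joined: Theorem U for `x₁` with `ab` contracted (`FK.theta_U_pivot`, `FK.apExpC_insert_root_contract`); neither: `ab`
deleted; exactly one: group further by the level of `E'` and apply Theorem U read by the nested pair (`FK.theta_U_pivot_nested`) whose
nesting inequality `H₀ ≤ H₁` is `hMIX` against the increments `β ↦ G(X ∪ β)`.  Consumed by `…MajMixCriterion.lean`.
[cite: Grimmett2006, §3.8 Thm. (3.90) (pp. 61–62); §3.9 (pp. 63–64)] [cite: Wagner2006, Thm. 5.8(d), §5.3]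
-/

noncomputable section

namespace Summit.CriticalPhenomena.PercolationContinuityZ3.Theorems

namespace FK

open SimpleGraph Literature.Probability.LatticeModels Literature.Probability.Percolation
open scoped Classical

variable {V : Type*} [Fintype V]

section Mixed

variable {E₁ E' : Finset (Sym2 V)} {V₁ V' : Set V} {a b : V}

set_option linter.unusedSimpArgs false in
/-- **The mixed part of the MIX criterion is nonnegative.**  See the module docstring: under `hMIX`, the sum over the configurations
`γ` of the host with exactly one of `x₂, x₃` in `γ` of `w(level)·σ_{x₁}(γ)·(g(γ ∪ C) − g((M \ γ) ∪ C))` is `≥ 0`.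
[cite: Grimmett2006, §3.8 Thm. (3.90) (pp. 61–62); §3.9 (pp. 63–64)] [cite: Wagner2006, Thm. 5.8(d), §5.3] -/
theorem apPsiCW_maj3_mixed_nonneg (hE₁ : IsTTSP E₁ a b) (hd : Disjoint E₁ E')
    (h₁ : ∀ e ∈ (↑E₁ : Set (Sym2 V)), ∀ z ∈ e, z ∈ V₁) (h' : ∀ e ∈ (↑E' : Set (Sym2 V)), ∀ z ∈ e, z ∈ V')
    (hV : V₁ ∩ V' ⊆ {a, b}) (heE₁ : s(a, b) ∉ E₁)
    {u₁ v₁ u₂ v₂ u₃ v₃ : V} (hx₁ : s(u₁, v₁) ∈ E₁) (hx₂ : s(u₂, v₂) ∈ E') (hx₃ : s(u₃, v₃) ∈ E')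
    (hx₂₃ : s(u₂, v₂) ≠ s(u₃, v₃))
    {N₁ C₁ N' C' : Finset (Sym2 V)} (hN₁ : N₁ ⊆ E₁) (hC₁ : C₁ ⊆ E₁) (hN' : N' ⊆ E') (hC' : C' ⊆ E')
    (hx₁N : s(u₁, v₁) ∉ N₁) (hx₁C : s(u₁, v₁) ∉ C₁) (hx₂N : s(u₂, v₂) ∉ N') (hx₃N : s(u₃, v₃) ∉ N')
    {w : ℕ → ℝ} (hw : ∀ n : ℕ, w (n + 1) ≤ w n) {g : Finset (Sym2 V) → ℝ}
    (hg₁ : ∀ A : Finset (Sym2 V), g (insert s(u₁, v₁) A) = g A) (hg₂ : ∀ A : Finset (Sym2 V), g (insert s(u₂, v₂) A) = g A)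
    (hg₃ : ∀ A : Finset (Sym2 V), g (insert s(u₃, v₃) A) = g A) (hmono : ∀ ⦃X Y : Finset (Sym2 V)⦄, X ⊆ Y → g X ≤ g Y)
    (hMIX : ∀ h : Finset (Sym2 V) → ℝ, (∀ ⦃A B : Finset (Sym2 V)⦄, A ⊆ B → B ⊆ N' → h A ≤ h B) → ∀ m : ℕ,
      0 ≤ ∑ β ∈ N'.powerset, h β *
        ((if apExpC (insert s(u₂, v₂) (insert s(u₃, v₃) N')) C' (insert s(u₂, v₂) β) = m then
            apConn (insert s(u₂, v₂) β ∪ C') a b -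
              apConn (insert s(u₂, v₂) (insert s(u₃, v₃) N') \ insert s(u₂, v₂) β ∪ C') a b else 0) +
          (if apExpC (insert s(u₂, v₂) (insert s(u₃, v₃) N')) C' (insert s(u₃, v₃) β) = m then
            apConn (insert s(u₃, v₃) β ∪ C') a b -
              apConn (insert s(u₂, v₂) (insert s(u₃, v₃) N') \ insert s(u₃, v₃) β ∪ C') a b else 0))) :
    0 ≤ ∑ γ ∈ (insert s(u₁, v₁) N₁ ∪ insert s(u₂, v₂) (insert s(u₃, v₃) N')).powerset,
      w (apExpC (insert s(u₁, v₁) N₁ ∪ insert s(u₂, v₂) (insert s(u₃, v₃) N')) (C₁ ∪ C') γ) *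
        (((if s(u₁, v₁) ∈ γ then (-1 : ℝ) else 1) *
          (if (s(u₂, v₂) ∈ γ ∧ s(u₃, v₃) ∉ γ) ∨ (s(u₂, v₂) ∉ γ ∧ s(u₃, v₃) ∈ γ) then (1 : ℝ) else 0)) *
          (g (γ ∪ (C₁ ∪ C')) - g ((insert s(u₁, v₁) N₁ ∪ insert s(u₂, v₂) (insert s(u₃, v₃) N')) \ γ ∪ (C₁ ∪ C')))) := by
  have hab : a ≠ b := hE₁.ne
  have hM₁E : insert s(u₁, v₁) N₁ ⊆ E₁ := Finset.insert_subset hx₁ hN₁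
  have hM'E : insert s(u₂, v₂) (insert s(u₃, v₃) N') ⊆ E' := Finset.insert_subset hx₂ (Finset.insert_subset hx₃ hN')
  have hdM : Disjoint (insert s(u₁, v₁) N₁) (insert s(u₂, v₂) (insert s(u₃, v₃) N')) :=
    Finset.disjoint_of_subset_left hM₁E (Finset.disjoint_of_subset_right hM'E hd)
  have nE' : ∀ {e : Sym2 V}, e ∈ E₁ → e ∉ E' := fun he he' => Finset.disjoint_left.1 hd he he'
  have nE₁ : ∀ {e : Sym2 V}, e ∈ E' → e ∉ E₁ := fun he' he => Finset.disjoint_left.1 hd he he'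
  have hx₁M' : s(u₁, v₁) ∉ insert s(u₂, v₂) (insert s(u₃, v₃) N') := fun h => nE' hx₁ (hM'E h)
  have hx₂M₁ : s(u₂, v₂) ∉ insert s(u₁, v₁) N₁ := fun h => nE₁ hx₂ (hM₁E h)
  have hx₃M₁ : s(u₃, v₃) ∉ insert s(u₁, v₁) N₁ := fun h => nE₁ hx₃ (hM₁E h)
  have hx₂N'' : s(u₂, v₂) ∉ insert s(u₃, v₃) N' := by rw [Finset.mem_insert, not_or]; exact ⟨hx₂₃, hx₂N⟩
  have he₁ : s(a, b) ≠ s(u₁, v₁) := fun h => heE₁ (h ▸ hx₁)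
  have heN₁ : s(a, b) ∉ N₁ := fun h => heE₁ (hN₁ h)
  have heM₁ : s(a, b) ∉ insert s(u₁, v₁) N₁ := by rw [Finset.mem_insert, not_or]; exact ⟨he₁, heN₁⟩
  set G : Finset (Sym2 V) → ℝ := fun X => g (X ∪ (C₁ ∪ C')) -
    g ((insert s(u₁, v₁) N₁ ∪ insert s(u₂, v₂) (insert s(u₃, v₃) N')) \ X ∪ (C₁ ∪ C')) with hGdef
  have hGmono : ∀ ⦃X Y : Finset (Sym2 V)⦄, X ⊆ Y → G X ≤ G Y := fun X Y hXY => incr_mono hmono _ _ hXY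
  have hG₁ : ∀ X : Finset (Sym2 V), G (insert s(u₁, v₁) X) = G X := fun X => incr_blind hg₁ _ _ X
  have hG₂ : ∀ X : Finset (Sym2 V), G (insert s(u₂, v₂) X) = G X := fun X => incr_blind hg₂ _ _ X
  have hG₃ : ∀ X : Finset (Sym2 V), G (insert s(u₃, v₃) X) = G X := fun X => incr_blind hg₃ _ _ X
  set W : ℕ → ℝ := fun n => w (n - 2 * Fintype.card V) with hWdef
  have hW : ∀ n, W (n + 1) ≤ W n := by
    intro n
    simp only [hWdef]
    rcases Nat.lt_or_ge n (2 * Fintype.card V) with h | h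
    · rw [show n + 1 - 2 * Fintype.card V = 0 by omega, show n - 2 * Fintype.card V = 0 by omega]
    · rw [show n + 1 - 2 * Fintype.card V = (n - 2 * Fintype.card V) + 1 by omega]; exact hw _
  have hwW : ∀ n, w n = W (n + 2 * Fintype.card V) := fun n => by simp only [hWdef, Nat.add_sub_cancel]
  have hR₁ : IsTTSP ((insert s(a, b) E₁).erase s(u₁, v₁)) u₁ v₁ :=
    hE₁.reroot_erase (Finset.mem_insert_of_mem hx₁) (insert_ne_singleton_of_isTTSP hE₁ heE₁ _)
  have subR₁ : ∀ {e : Sym2 V}, e ∈ insert s(a, b) E₁ → e ≠ s(u₁, v₁) → e ∈ (insert s(a, b) E₁).erase s(u₁, v₁) :=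
    fun he hne => Finset.mem_erase.2 ⟨hne, he⟩
  have hN₁R : N₁ ⊆ (insert s(a, b) E₁).erase s(u₁, v₁) :=
    fun e he => subR₁ (Finset.mem_insert_of_mem (hN₁ he)) (fun h => hx₁N (h ▸ he))
  have hC₁R : C₁ ⊆ (insert s(a, b) E₁).erase s(u₁, v₁) :=
    fun e he => subR₁ (Finset.mem_insert_of_mem (hC₁ he)) (fun h => hx₁C (h ▸ he))
  have heR : s(a, b) ∈ (insert s(a, b) E₁).erase s(u₁, v₁) := subR₁ (Finset.mem_insert_self _ _) he₁
  have hCabR : insert s(a, b) C₁ ⊆ (insert s(a, b) E₁).erase s(u₁, v₁) := Finset.insert_subset heR hC₁R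
  have hNabR : insert s(a, b) N₁ ⊆ (insert s(a, b) E₁).erase s(u₁, v₁) := Finset.insert_subset heR hN₁R
  have hx₁Nab : s(u₁, v₁) ∉ insert s(a, b) N₁ := by rw [Finset.mem_insert, not_or]; exact ⟨he₁.symm, hx₁N⟩
  -- abbreviations for the pair `E'`
  set A' : Finset (Sym2 V) → ℕ := fun γ' => apExpC (insert s(u₂, v₂) (insert s(u₃, v₃) N')) C' γ' with hA'
  set mixI : Finset (Sym2 V) → ℝ := fun γ' =>
    if (s(u₂, v₂) ∈ γ' ∧ s(u₃, v₃) ∉ γ') ∨ (s(u₂, v₂) ∉ γ' ∧ s(u₃, v₃) ∈ γ') then (1 : ℝ) else 0 with hmixI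
  have mixI_nn : ∀ γ', 0 ≤ mixI γ' := fun γ' => by simp only [hmixI]; split_ifs <;> norm_num
  -- the four aggregated inner sums
  set X11 : Finset (Sym2 V) → ℝ := fun γ' => ∑ γ₁ ∈ (insert s(u₁, v₁) N₁).powerset,
    G (γ₁ ∪ γ') * (if s(u₁, v₁) ∈ γ₁ then (-1 : ℝ) else 1) *
      W (apExpC (insert s(u₁, v₁) N₁) (insert s(a, b) C₁) γ₁ + (A' γ' + 2)) with hX11
  set X00 : Finset (Sym2 V) → ℝ := fun γ' => ∑ γ₁ ∈ (insert s(u₁, v₁) N₁).powerset,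
    G (γ₁ ∪ γ') * (if s(u₁, v₁) ∈ γ₁ then (-1 : ℝ) else 1) *
      W (apExpC (insert s(u₁, v₁) N₁) C₁ γ₁ + A' γ') with hX00
  set X10 : Finset (Sym2 V) → ℝ := fun γ' => ∑ γ₁ ∈ (insert s(u₁, v₁) N₁).powerset,
    G (γ₁ ∪ γ') * (if s(u₁, v₁) ∈ γ₁ then (-1 : ℝ) else 1) *
      W (apExpC (insert s(a, b) (insert s(u₁, v₁) N₁)) C₁ (insert s(a, b) γ₁) + (A' γ' + 1)) with hX10
  set X01 : Finset (Sym2 V) → ℝ := fun γ' => ∑ γ₁ ∈ (insert s(u₁, v₁) N₁).powerset,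
    G (γ₁ ∪ γ') * (if s(u₁, v₁) ∈ γ₁ then (-1 : ℝ) else 1) *
      W (apExpC (insert s(a, b) (insert s(u₁, v₁) N₁)) C₁ γ₁ + (A' γ' + 1)) with hX01
  -- (3a–c) bridge + grouping of the `x₁`-flips by the state of `E'`
  have bridge : ∑ γ ∈ (insert s(u₁, v₁) N₁ ∪ insert s(u₂, v₂) (insert s(u₃, v₃) N')).powerset,
      w (apExpC (insert s(u₁, v₁) N₁ ∪ insert s(u₂, v₂) (insert s(u₃, v₃) N')) (C₁ ∪ C') γ) *
        (((if s(u₁, v₁) ∈ γ then (-1 : ℝ) else 1) *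
          (if (s(u₂, v₂) ∈ γ ∧ s(u₃, v₃) ∉ γ) ∨ (s(u₂, v₂) ∉ γ ∧ s(u₃, v₃) ∈ γ) then (1 : ℝ) else 0)) * G γ) =
      ∑ γ' ∈ (insert s(u₂, v₂) (insert s(u₃, v₃) N')).powerset, mixI γ' *
        (if (openGraph (↑(γ' ∪ C') : BondConfig V)).Reachable a b then
          (if (openGraph (↑(insert s(u₂, v₂) (insert s(u₃, v₃) N') \ γ' ∪ C') : BondConfig V)).Reachable a b then X11 γ' else X10 γ')
         else
          (if (openGraph (↑(insert s(u₂, v₂) (insert s(u₃, v₃) N') \ γ' ∪ C') : BondConfig V)).Reachable a b then X01 γ' else X00 γ')) := by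
    rw [sum_powerset_union_disj hdM, Finset.sum_comm]
    refine Finset.sum_congr rfl fun γ' hγ' => ?_
    have hγ'M := Finset.mem_powerset.1 hγ'
    have hx₁γ' : s(u₁, v₁) ∉ γ' := fun h => hx₁M' (hγ'M h)
    by_cases hc : (openGraph (↑(γ' ∪ C') : BondConfig V)).Reachable a b <;>
      by_cases hcb : (openGraph (↑(insert s(u₂, v₂) (insert s(u₃, v₃) N') \ γ' ∪ C') : BondConfig V)).Reachable a b <;>
      simp only [hc, hcb, if_true, if_false, hX11, hX10, hX01, hX00, Finset.mul_sum] <;>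
      refine Finset.sum_congr rfl fun γ₁ hγ₁ => ?_
    all_goals
      have hγ₁M := Finset.mem_powerset.1 hγ₁
      have hx₂γ₁ : s(u₂, v₂) ∉ γ₁ := fun h => hx₂M₁ (hγ₁M h)
      have hx₃γ₁ : s(u₃, v₃) ∉ γ₁ := fun h => hx₃M₁ (hγ₁M h)
      have e := apExpC_parallel hd h₁ h' hV hab hM₁E hM'E hC₁ hC' hγ₁M hγ'M
      rw [hwW, e]
      simp only [Finset.mem_union, hx₁γ', or_false, hx₂γ₁, hx₃γ₁, false_or, hc, hcb, and_true, and_false, if_false,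
        add_zero, zero_add, hmixI, hA']
    · have k := apExpC_insert_root_contract (M := insert s(u₁, v₁) N₁) (C := C₁) (γ := γ₁) (a := a) (b := b)
      have hlev : apExpC (insert s(u₁, v₁) N₁) C₁ γ₁ + apExpC (insert s(u₂, v₂) (insert s(u₃, v₃) N')) C' γ' +
          ((if (openGraph (↑(γ₁ ∪ C₁) : BondConfig V)).Reachable a b then 1 else 0) +
            (if (openGraph (↑(insert s(u₁, v₁) N₁ \ γ₁ ∪ C₁) : BondConfig V)).Reachable a b then 1 else 0)) =
          apExpC (insert s(u₁, v₁) N₁) (insert s(a, b) C₁) γ₁ + (apExpC (insert s(u₂, v₂) (insert s(u₃, v₃) N')) C' γ' + 2) := by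
        split_ifs at k ⊢ <;> omega
      rw [hlev]; ring
    · have k := apExpC_insert_root_live₁ (M := insert s(u₁, v₁) N₁) (C := C₁) (γ := γ₁) (a := a) (b := b) heM₁
      have hlev : apExpC (insert s(u₁, v₁) N₁) C₁ γ₁ + apExpC (insert s(u₂, v₂) (insert s(u₃, v₃) N')) C' γ' +
          (if (openGraph (↑(γ₁ ∪ C₁) : BondConfig V)).Reachable a b then 1 else 0) =
          apExpC (insert s(a, b) (insert s(u₁, v₁) N₁)) C₁ (insert s(a, b) γ₁) +
            (apExpC (insert s(u₂, v₂) (insert s(u₃, v₃) N')) C' γ' + 1) := by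
        split_ifs at k ⊢ <;> omega
      rw [hlev]; ring
    · have k := apExpC_insert_root_live₂ (M := insert s(u₁, v₁) N₁) (C := C₁) (γ := γ₁) (a := a) (b := b) heM₁ hγ₁M
      have hlev : apExpC (insert s(u₁, v₁) N₁) C₁ γ₁ + apExpC (insert s(u₂, v₂) (insert s(u₃, v₃) N')) C' γ' +
          (if (openGraph (↑(insert s(u₁, v₁) N₁ \ γ₁ ∪ C₁) : BondConfig V)).Reachable a b then 1 else 0) =
          apExpC (insert s(a, b) (insert s(u₁, v₁) N₁)) C₁ γ₁ +
            (apExpC (insert s(u₂, v₂) (insert s(u₃, v₃) N')) C' γ' + 1) := by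
        split_ifs at k ⊢ <;> omega
      rw [hlev]; ring
    · ring
  rw [bridge]
  -- (3d) split by the state of `E'`
  have split : ∀ γ' : Finset (Sym2 V), mixI γ' *
        (if (openGraph (↑(γ' ∪ C') : BondConfig V)).Reachable a b then
          (if (openGraph (↑(insert s(u₂, v₂) (insert s(u₃, v₃) N') \ γ' ∪ C') : BondConfig V)).Reachable a b then X11 γ' else X10 γ')
         else
          (if (openGraph (↑(insert s(u₂, v₂) (insert s(u₃, v₃) N') \ γ' ∪ C') : BondConfig V)).Reachable a b then X01 γ' else X00 γ')) =
      mixI γ' * (if (openGraph (↑(γ' ∪ C') : BondConfig V)).Reachable a b ∧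
            (openGraph (↑(insert s(u₂, v₂) (insert s(u₃, v₃) N') \ γ' ∪ C') : BondConfig V)).Reachable a b then X11 γ' else 0) +
        mixI γ' * (if ¬ (openGraph (↑(γ' ∪ C') : BondConfig V)).Reachable a b ∧
            ¬ (openGraph (↑(insert s(u₂, v₂) (insert s(u₃, v₃) N') \ γ' ∪ C') : BondConfig V)).Reachable a b then X00 γ' else 0) +
        mixI γ' * ((if (openGraph (↑(γ' ∪ C') : BondConfig V)).Reachable a b ∧
            ¬ (openGraph (↑(insert s(u₂, v₂) (insert s(u₃, v₃) N') \ γ' ∪ C') : BondConfig V)).Reachable a b then X10 γ' else 0) +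
          (if ¬ (openGraph (↑(γ' ∪ C') : BondConfig V)).Reachable a b ∧
            (openGraph (↑(insert s(u₂, v₂) (insert s(u₃, v₃) N') \ γ' ∪ C') : BondConfig V)).Reachable a b then X01 γ' else 0)) := by
    intro γ'
    by_cases hc : (openGraph (↑(γ' ∪ C') : BondConfig V)).Reachable a b <;>
      by_cases hcb : (openGraph (↑(insert s(u₂, v₂) (insert s(u₃, v₃) N') \ γ' ∪ C') : BondConfig V)).Reachable a b <;>
      simp only [hc, hcb, if_true, if_false, not_true, not_false_iff, and_true, and_false, true_and, false_and] <;> ring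
  simp only [split]
  rw [Finset.sum_add_distrib, Finset.sum_add_distrib]
  -- the H-test functions of the `11` and `00` parts
  have monoγ : ∀ γ' : Finset (Sym2 V), ∀ ⦃X Y : Finset (Sym2 V)⦄, X ⊆ Y → Y ⊆ N₁ → G (X ∪ γ') ≤ G (Y ∪ γ') :=
    fun γ' X Y hXY _ => hGmono (Finset.union_subset_union hXY le_rfl)
  have blindγ : ∀ γ' : Finset (Sym2 V), ∀ X : Finset (Sym2 V), G (insert s(u₁, v₁) X ∪ γ') = G (X ∪ γ') :=
    fun γ' X => by rw [Finset.insert_union, hG₁]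
  refine add_nonneg (add_nonneg (Finset.sum_nonneg fun γ' _ => mul_nonneg (mixI_nn γ') ?_)
    (Finset.sum_nonneg fun γ' _ => mul_nonneg (mixI_nn γ') ?_)) ?_
  · split_ifs
    · exact theta_U_pivot hR₁ hN₁R hCabR hx₁N hW (H := fun X => G (X ∪ γ')) (monoγ γ') (blindγ γ') (A' γ' + 2)
    · exact le_rfl
  · split_ifs
    · exact theta_U_pivot hR₁ hN₁R hC₁R hx₁N hW (H := fun X => G (X ∪ γ')) (monoγ γ') (blindγ γ') (A' γ')
    · exact le_rfl
  -- (3e) the `10`/`01` parts, grouped by the level of `E'`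
  rw [← Finset.sum_fiberwise_of_maps_to (s := (insert s(u₂, v₂) (insert s(u₃, v₃) N')).powerset)
    (t := ((insert s(u₂, v₂) (insert s(u₃, v₃) N')).powerset).image A') (g := A') (fun γ' h => Finset.mem_image_of_mem _ h)]
  refine Finset.sum_nonneg fun m _ => ?_
  rw [Finset.sum_filter]
  -- the nested test functions at level `m`
  set H₁ : Finset (Sym2 V) → ℝ := fun X => ∑ γ' ∈ (insert s(u₂, v₂) (insert s(u₃, v₃) N')).powerset,
    (if A' γ' = m then mixI γ' * (if (openGraph (↑(γ' ∪ C') : BondConfig V)).Reachable a b ∧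
        ¬ (openGraph (↑(insert s(u₂, v₂) (insert s(u₃, v₃) N') \ γ' ∪ C') : BondConfig V)).Reachable a b then G (X ∪ γ') else 0)
      else 0) with hH₁
  set H₀ : Finset (Sym2 V) → ℝ := fun X => ∑ γ' ∈ (insert s(u₂, v₂) (insert s(u₃, v₃) N')).powerset,
    (if A' γ' = m then mixI γ' * (if ¬ (openGraph (↑(γ' ∪ C') : BondConfig V)).Reachable a b ∧
        (openGraph (↑(insert s(u₂, v₂) (insert s(u₃, v₃) N') \ γ' ∪ C') : BondConfig V)).Reachable a b then G (X ∪ γ') else 0)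
      else 0) with hH₀
  -- (F1) swap the sums
  have F1 : ∑ γ' ∈ (insert s(u₂, v₂) (insert s(u₃, v₃) N')).powerset,
      (if A' γ' = m then mixI γ' *
        ((if (openGraph (↑(γ' ∪ C') : BondConfig V)).Reachable a b ∧
            ¬ (openGraph (↑(insert s(u₂, v₂) (insert s(u₃, v₃) N') \ γ' ∪ C') : BondConfig V)).Reachable a b then X10 γ' else 0) +
          (if ¬ (openGraph (↑(γ' ∪ C') : BondConfig V)).Reachable a b ∧
            (openGraph (↑(insert s(u₂, v₂) (insert s(u₃, v₃) N') \ γ' ∪ C') : BondConfig V)).Reachable a b then X01 γ' else 0))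
       else 0) =
      ∑ γ₁ ∈ (insert s(u₁, v₁) N₁).powerset, (if s(u₁, v₁) ∈ γ₁ then (-1 : ℝ) else 1) *
        (W (apExpC (insert s(a, b) (insert s(u₁, v₁) N₁)) C₁ (insert s(a, b) γ₁) + (m + 1)) * H₁ γ₁ +
          W (apExpC (insert s(a, b) (insert s(u₁, v₁) N₁)) C₁ γ₁ + (m + 1)) * H₀ γ₁) := by
    have pw : ∀ γ' ∈ (insert s(u₂, v₂) (insert s(u₃, v₃) N')).powerset,
        (if A' γ' = m then mixI γ' *
          ((if (openGraph (↑(γ' ∪ C') : BondConfig V)).Reachable a b ∧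
              ¬ (openGraph (↑(insert s(u₂, v₂) (insert s(u₃, v₃) N') \ γ' ∪ C') : BondConfig V)).Reachable a b then X10 γ' else 0) +
            (if ¬ (openGraph (↑(γ' ∪ C') : BondConfig V)).Reachable a b ∧
              (openGraph (↑(insert s(u₂, v₂) (insert s(u₃, v₃) N') \ γ' ∪ C') : BondConfig V)).Reachable a b then X01 γ' else 0))
         else 0) =
        ∑ γ₁ ∈ (insert s(u₁, v₁) N₁).powerset, (if s(u₁, v₁) ∈ γ₁ then (-1 : ℝ) else 1) *
          (W (apExpC (insert s(a, b) (insert s(u₁, v₁) N₁)) C₁ (insert s(a, b) γ₁) + (m + 1)) *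
              (if A' γ' = m then mixI γ' * (if (openGraph (↑(γ' ∪ C') : BondConfig V)).Reachable a b ∧
                  ¬ (openGraph (↑(insert s(u₂, v₂) (insert s(u₃, v₃) N') \ γ' ∪ C') : BondConfig V)).Reachable a b
                then G (γ₁ ∪ γ') else 0) else 0) +
            W (apExpC (insert s(a, b) (insert s(u₁, v₁) N₁)) C₁ γ₁ + (m + 1)) *
              (if A' γ' = m then mixI γ' * (if ¬ (openGraph (↑(γ' ∪ C') : BondConfig V)).Reachable a b ∧
                  (openGraph (↑(insert s(u₂, v₂) (insert s(u₃, v₃) N') \ γ' ∪ C') : BondConfig V)).Reachable a b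
                then G (γ₁ ∪ γ') else 0) else 0)) := by
      intro γ' _
      by_cases hm : A' γ' = m
      · by_cases hc : (openGraph (↑(γ' ∪ C') : BondConfig V)).Reachable a b <;>
          by_cases hcb : (openGraph (↑(insert s(u₂, v₂) (insert s(u₃, v₃) N') \ γ' ∪ C') : BondConfig V)).Reachable a b <;>
          simp only [hm, hc, hcb, if_true, if_false, not_true, not_false_iff, and_true, and_false, true_and, false_and,
            hX10, hX01, add_zero, zero_add, mul_zero, Finset.mul_sum, Finset.sum_const_zero] <;>
          (try (refine Finset.sum_congr rfl fun γ₁ _ => ?_; rw [← hm]; ring))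
      · simp only [hm, if_false, mul_zero, add_zero, zero_add, Finset.sum_const_zero]
    rw [Finset.sum_congr rfl pw, Finset.sum_comm]
    refine Finset.sum_congr rfl fun γ₁ _ => ?_
    simp only [hH₁, hH₀]
    rw [Finset.mul_sum, Finset.mul_sum, ← Finset.sum_add_distrib, Finset.mul_sum]
  rw [F1]
  -- (F3) monotonicity, blindness and the nesting inequality `H₀ ≤ H₁` (= hMIX)
  have term_mono : ∀ (P Q : Prop) [Decidable P] [Decidable Q] (γ' : Finset (Sym2 V)) ⦃X Y : Finset (Sym2 V)⦄, X ⊆ Y →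
      (if P then mixI γ' * (if Q then G (X ∪ γ') else 0) else 0) ≤ (if P then mixI γ' * (if Q then G (Y ∪ γ') else 0) else 0) := by
    intro P Q _ _ γ' X Y hXY
    split_ifs
    · exact mul_le_mul_of_nonneg_left (hGmono (Finset.union_subset_union hXY le_rfl)) (mixI_nn γ')
    · exact le_rfl
    · exact le_rfl
  have hmono₁ : ∀ ⦃X Y : Finset (Sym2 V)⦄, X ⊆ Y → Y ⊆ insert s(a, b) N₁ → H₁ X ≤ H₁ Y :=
    fun X Y hXY _ => Finset.sum_le_sum fun γ' _ => term_mono _ _ γ' hXY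
  have hmono₀ : ∀ ⦃X Y : Finset (Sym2 V)⦄, X ⊆ Y → Y ⊆ insert s(a, b) N₁ → H₀ X ≤ H₀ Y :=
    fun X Y hXY _ => Finset.sum_le_sum fun γ' _ => term_mono _ _ γ' hXY
  have hH₁x : ∀ X : Finset (Sym2 V), H₁ (insert s(u₁, v₁) X) = H₁ X := fun X => by
    simp only [hH₁, Finset.insert_union, hG₁]
  have hH₀x : ∀ X : Finset (Sym2 V), H₀ (insert s(u₁, v₁) X) = H₀ X := fun X => by
    simp only [hH₀, Finset.insert_union, hG₁]
  have hle : ∀ ⦃X : Finset (Sym2 V)⦄, X ⊆ insert s(a, b) N₁ → H₀ X ≤ H₁ X := by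
    intro X _
    rw [← sub_nonneg]
    -- H₁ X − H₀ X is the mixed root functional of `E'` against the increment `β ↦ G (X ∪ β)`
    have F4 : H₁ X - H₀ X = ∑ β ∈ N'.powerset, G (X ∪ β) *
        ((if apExpC (insert s(u₂, v₂) (insert s(u₃, v₃) N')) C' (insert s(u₂, v₂) β) = m then
            apConn (insert s(u₂, v₂) β ∪ C') a b -
              apConn (insert s(u₂, v₂) (insert s(u₃, v₃) N') \ insert s(u₂, v₂) β ∪ C') a b else 0) +
          (if apExpC (insert s(u₂, v₂) (insert s(u₃, v₃) N')) C' (insert s(u₃, v₃) β) = m then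
            apConn (insert s(u₃, v₃) β ∪ C') a b -
              apConn (insert s(u₂, v₂) (insert s(u₃, v₃) N') \ insert s(u₃, v₃) β ∪ C') a b else 0)) := by
      simp only [hH₁, hH₀, ← Finset.sum_sub_distrib]
      -- pointwise: (10-part) − (01-part) = mixI * G * (c − c̄)
      have pw : ∀ γ' : Finset (Sym2 V),
          (if A' γ' = m then mixI γ' * (if (openGraph (↑(γ' ∪ C') : BondConfig V)).Reachable a b ∧
              ¬ (openGraph (↑(insert s(u₂, v₂) (insert s(u₃, v₃) N') \ γ' ∪ C') : BondConfig V)).Reachable a b then G (X ∪ γ') else 0)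
            else 0) -
          (if A' γ' = m then mixI γ' * (if ¬ (openGraph (↑(γ' ∪ C') : BondConfig V)).Reachable a b ∧
              (openGraph (↑(insert s(u₂, v₂) (insert s(u₃, v₃) N') \ γ' ∪ C') : BondConfig V)).Reachable a b then G (X ∪ γ') else 0)
            else 0) =
          (if A' γ' = m then mixI γ' * G (X ∪ γ') *
            (apConn (γ' ∪ C') a b - apConn (insert s(u₂, v₂) (insert s(u₃, v₃) N') \ γ' ∪ C') a b) else 0) := by
        intro γ'
        unfold apConn
        by_cases hm : A' γ' = m <;>
          by_cases hc : (openGraph (↑(γ' ∪ C') : BondConfig V)).Reachable a b <;>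
          by_cases hcb : (openGraph (↑(insert s(u₂, v₂) (insert s(u₃, v₃) N') \ γ' ∪ C') : BondConfig V)).Reachable a b <;>
          simp only [hm, hc, hcb, if_true, if_false, not_true, not_false_iff, and_true, and_false, true_and, false_and] <;> ring
      simp only [pw]
      rw [Finset.sum_powerset_insert hx₂N'', Finset.sum_powerset_insert hx₃N, Finset.sum_powerset_insert hx₃N,
        ← Finset.sum_add_distrib, ← Finset.sum_add_distrib, ← Finset.sum_add_distrib]
      refine Finset.sum_congr rfl fun β hβ => ?_
      have hβN := Finset.mem_powerset.1 hβ
      have hx₂β : s(u₂, v₂) ∉ β := fun h => hx₂N (hβN h)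
      have hx₃β : s(u₃, v₃) ∉ β := fun h => hx₃N (hβN h)
      have hx₂β' : s(u₂, v₂) ∉ insert s(u₃, v₃) β := by rw [Finset.mem_insert, not_or]; exact ⟨hx₂₃, hx₂β⟩
      have g2 : G (X ∪ insert s(u₂, v₂) β) = G (X ∪ β) := by rw [Finset.union_insert, hG₂]
      have g3 : G (X ∪ insert s(u₃, v₃) β) = G (X ∪ β) := by rw [Finset.union_insert, hG₃]
      simp only [hmixI, hA', Finset.mem_insert_self, Finset.mem_insert, hx₂β, hx₃β, hx₂₃, hx₂₃.symm, true_or, or_true,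
        or_false, false_or, not_true, not_false_iff, and_true, and_false, true_and, false_and, if_true, if_false, or_self,
        g2, g3]
      split_ifs <;> ring
    rw [F4]
    exact hMIX (fun β => G (X ∪ β)) (fun A B hAB _ => hGmono (Finset.union_subset_union le_rfl hAB)) m
  exact theta_U_pivot_nested hR₁ hNabR hC₁R hx₁Nab heN₁ hW hle hmono₀ hmono₁ hH₀x hH₁x (m + 1)

end Mixed

end FK

end Summit.CriticalPhenomena.PercolationContinuityZ3.Theorems

end
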